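import Summits.BirchSwinnertonDyer.Rank1Residual.Additive.X3BranchDegenerateEndStateCardGe
import Summits.BirchSwinnertonDyer.Rank1Residual.Additive.X3BranchResidualLineH1LowerBound
import Summits.BirchSwinnertonDyer.Rank1Residual.Additive.X3BranchResidualQuotSelmerLowerBound
import HarnessLib

/-!
# X3, the DEGENERATE rows at `p = 3`, rank `0`: the END STATE fed by EXHIBITED classes
# (cell `bsd-eis`, seat `bsd-eis-x3` gen 6; sequel of `X3BranchDegenerateEndStateCardGe.lean`;
# route K1 `AdditiveBranchIMC`, crux `GordTwoRankZeroOffCaseOne` — supports only)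

HONEST FRAMING (`run/shared/lean/pub/bsd-eis/README.md` §4): the programme's target of record is the
full Birch–Swinnerton-Dyer formula for every `E/ℚ` of analytic rank `≤ 1`; this file concerns the
DEGENERATE X3♯(G-ord, `e = 2`) rows at `p = 3` only. THEOREMS ONLY (no `def`, no named fact beyond the
PUBLISHED records already displayed by the predecessor, no `sorry`); nothing is booked; no label, tier
or count of record moves here.

The end state `ClassX3Gord.bsdp_three_rankZero_degenerate_of_facts_of_torsionFact_of_cardGe` asks,
per pair, for the finiteness-conditional lower bound
`hnge : 3^{n+Σδ+1} ≤ #H¹(ℚ_Σ/ℚ_∞, Φ₀) · #U(W[3]/Φ₀)`.  Both factors now have EXHIBITED lower bounds: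
* `X3Branch.pow_card_le_natCard_residualLineH1_of_trivialLine` — `3^{#T} ≤ #H¹` from the order-`3`
  sub-characters of the mod-`ℓ` cyclotomic characters, `ℓ ∈ T` primes under `Σ₀` with `3 ∣ ℓ − 1`;
* `X3Branch.pow_card_le_natCard_residualQuotSelmer_of_trivialLine` — `3^{#ι} ≤ #U` from the Kummer
  classes of `Σ₀`-units `a_i` with independent prime supports that are cubes in `ℚ₃` (certificates).
So `hnge` is discharged by the per-pair ARITHMETIC `n + Σδ + 1 ≤ #T + #ι`:
`ClassX3Gord.bsdp_three_rankZero_degenerate_of_facts_of_torsionFact_of_classes`.  On the sub-locus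
"every `ℓ ∈ Σ₀` has `ℓ ≢ ±1 (mod 9)`" of the unit rows (`n = 0`; 616 of the 1 381 rank-`0` classes of
referee A's residue at state 16a6b5d318458b9f) one has `Σδ + 1 = #{ℓ ∈ Σ₀ : ℓ ≡ 1 (3)} + #Σ₀ − 1`, met by
`T = {ℓ ∈ Σ₀ : ℓ ≡ 1 (3)}` and `#Σ₀ − 1` units (x3-MEMO-2 D3; `NOTES.md` of the seat, `## FINDINGS`).
References: [GreenbergVatsal2000] §2 pp. 26–30; [Greenberg1999] = [GreenbergLNM1716] §1, §3;
[SerreLocalFields1979] Ch. X §3; [Cassels1986] Ch. 4 Lemma 3.1.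
-/

set_option autoImplicit false

noncomputable section

open scoped Classical AddSubgroup

namespace Summit.BirchSwinnertonDyer.Rank1Residual.Additive

open WeierstrassCurve NumberField IsDedekindDomain Field
  Literature.NumberTheory.EllipticCurves
  Literature.NumberTheory.EllipticCurves.ModularForms
  Literature.NumberTheory.EllipticCurves.GreenbergSelmer
  Literature.NumberTheory.EllipticCurves.GreenbergVatsal2000
  Literature.NumberTheory.EllipticCurves.Rank1Residual
  Literature.NumberTheory.EllipticCurves.Rank1Residual.Typed
  Literature.NumberTheory.GaloisRepresentations
  Summit.BirchSwinnertonDyer.Rank1Residual.X1.MuLambda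
  Summit.BirchSwinnertonDyer.Rank1Residual.AdditivePotMult
  Summit.BirchSwinnertonDyer.Rank1Residual.Additive.X3Branch

/-- **`BSD₃(W)` on the DEGENERATE X3♯(G-ord, `e = 2`) rows of rank `0` from EXHIBITED classes.**
The end state `ClassX3Gord.bsdp_three_rankZero_degenerate_of_facts_of_torsionFact_of_cardGe` with its
finiteness-conditional lower bound `hnge : 3^{n+Σδ+1} ≤ #H¹(ℚ_Σ/ℚ_∞, Φ₀)·#U(W[3]/Φ₀)` DISCHARGED by
* a set `T` of primes `ℓ ≡ 1 (mod 3)` lying under `Σ₀` (`3^{#T} ≤ #H¹`,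
  `X3Branch.pow_card_le_natCard_residualLineH1_of_trivialLine`),
* a family `(a_i, ℓ_i, c_i)_{i ∈ ι}` of natural numbers `a_i ≠ 0` with `ℓ_i ∥ a_i`, `ℓ_i ∤ a_j`
  (`i ≠ j`), every prime of `a_i` under `Σ₀`, `3 ∤ c_i`, `27 ∣ c_i³ − a_i` (`3^{#ι} ≤ #U`,
  `X3Branch.pow_card_le_natCard_residualQuotSelmer_of_trivialLine`),
* the arithmetic `n + Σ_{v ∈ Σ₀} δ_v + 1 ≤ #T + #ι`.
What stays displayed per pair: the class/rank/`Σ₀`/good-reduction data, the trivial rational line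
`Φ₀`, the unit-coefficient certificate `hcert` at index `n` on every twist model, and the PUBLISHED
records `hTors … hLiftE` of the predecessor (verbatim). [cite: GreenbergVatsal2000, §2 pp. 26–30]
[cite: GreenbergLNM1716, §3 p. 86] [cite: Delbourgo1998, Prop. 4] [cite: Wuthrich2014, Thm. 16] -/
theorem ClassX3Gord.bsdp_three_rankZero_degenerate_of_facts_of_torsionFact_of_classes
    [Fact (Nat.Prime 3)] {W : WeierstrassCurve ℚ} [W.IsElliptic] [W.IsGloballyMinimal]
    (hTors : Greenberg1999.finite_torsion_cyclotomicZpExtension)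
    (hDelG : Delbourgo1998.prop4_rankZero_constantCoeff_eq_unit_mul_of_potGoodOrd)
    (hDel98 : Delbourgo1998.prop4_rankZero_pow_dvd_constantCoeff)
    (hGZK : rank_eq_analyticRank_of_analyticRank_le_one) (hmod : hasEntireLFunction_rat)
    (hmodD : nonempty_modularParametrizationData)
    (hW16 : Wuthrich2014.thm16_halfEigenCharIdeal_dvd_cyclotomicPrime)
    (h23 : datumSelmer_nonPrimitive_invariants)
    (hRQ : datumSelmer_divisible_of_finite_torsionBy_of_gr_inertiaInvariants_eq_zero)
    (hGrK : Greenberg1999.imKummer_ge_strictCondition_goodOrdinary)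
    (hLiftE : residualEpsilon_surjOn_of_lineEven)
    (hX : ClassX3Gord W 3) (hr : W.analyticRank = 0)
    (S₀ : Finset (HeightOneSpectrum (𝓞 ℚ))) (hne : S₀.Nonempty)
    (hS₀ : ∀ v ∈ S₀, (((3 : ℕ) : ℕ) : 𝓞 ℚ) ∉ v.asIdeal)
    (hS : ∀ v : HeightOneSpectrum (𝓞 ℚ), v ∉ S₀ → (((3 : ℕ) : ℕ) : 𝓞 ℚ) ∉ v.asIdeal →
      W.HasGoodReductionAt v)
    (Φ₀ : AddSubgroup (W.geomTorsion ((3 : ℕ) : ℤ))) (hΦ : IsRationalLine W 3 Φ₀)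
    (htriv : ∀ (σ : absoluteGaloisGroup ℚ) (P : geomTorsion W ((3 : ℕ) : ℤ)), P ∈ Φ₀ → σ • P = P)
    {n : ℕ}
    (hcert : ∀ (V : WeierstrassCurve ℚ) [V.IsElliptic] [V.IsGloballyMinimal] (C : VariableChange ℚ),
      C • V.quadraticTwist ((-1) ^ ((3 : ℕ) / 2) * (3 : ℕ) : ℚ) = W → X3BranchUnitCoeffCertAt V 3 n)
    (T : Finset ℕ) (hT : ∀ ℓ ∈ T, ℓ.Prime ∧ 3 ∣ ℓ - 1 ∧ ∃ v ∈ S₀, ((ℓ : ℕ) : 𝓞 ℚ) ∈ v.asIdeal)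
    {ι : Type} [Fintype ι] (a ℓ : ι → ℕ) (c : ι → ℤ) (ha : ∀ i, a i ≠ 0)
    (hℓ : ∀ i, (ℓ i).Prime) (hval : ∀ i j, padicValNat (ℓ i) (a j) = if i = j then 1 else 0)
    (haS : ∀ i (v : HeightOneSpectrum (𝓞 ℚ)), ((a i : ℕ) : 𝓞 ℚ) ∈ v.asIdeal → v ∈ S₀)
    (hc : ∀ i, ¬ (3 : ℤ) ∣ c i) (hcube : ∀ i, (27 : ℤ) ∣ c i ^ 3 - a i)
    (hcount : n + ∑ v ∈ S₀, delta W 3 v + 1 ≤ T.card + Fintype.card ι) :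
    BSDp W 3 := by
  refine ClassX3Gord.bsdp_three_rankZero_degenerate_of_facts_of_torsionFact_of_cardGe hTors hDelG
    hDel98 hGZK hmod hmodD hW16 h23 hRQ hGrK hLiftE hX hr S₀ hne hS₀ hS Φ₀ hΦ htriv hcert
    fun κ hκ hH hU ↦ ?_
  haveI := hH
  haveI := hU
  calc 3 ^ (n + ∑ v ∈ S₀, delta W 3 v + 1) ≤ 3 ^ (T.card + Fintype.card ι) :=
        Nat.pow_le_pow_right (by norm_num) hcount
    _ = 3 ^ T.card * 3 ^ Fintype.card ι := pow_add _ _ _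
    _ ≤ Nat.card (residualLineH1 W 3 κ S₀ Φ₀ hΦ) * Nat.card (residualQuotSelmer W 3 κ S₀ Φ₀ hΦ) :=
        Nat.mul_le_mul
          (X3Branch.pow_card_le_natCard_residualLineH1_of_trivialLine κ hκ S₀ hS₀ hΦ htriv T hT)
          (X3Branch.pow_card_le_natCard_residualQuotSelmer_of_trivialLine κ S₀ hΦ htriv a ℓ c ha
            hℓ hval haS hc hcube)

end Summit.BirchSwinnertonDyer.Rank1Residual.Additive

end
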